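import Mathlib.Algebra.Exact.Basic
import Literature.Algebra.Homology.DoubleComplexExactRows
import HarnessLib

/-!
# The long exact cohomology sequence of a short exact sequence of cochain complexes

C. A. Weibel, *An Introduction to Homological Algebra* (1994), Thm. 1.3.1 (p. 10): a short exact
sequence `0 → A → B → C → 0` of cochain complexes gives natural connecting homomorphisms
`∂ : Hⁿ(C) → Hⁿ⁺¹(A)` and a long exact sequence
`⋯ → Hⁿ(A) → Hⁿ(B) → Hⁿ(C) → Hⁿ⁺¹(A) → Hⁿ⁺¹(B) → ⋯`; the construction of `∂` is the snake
lemma (Weibel 1.3.2: lift a cocycle `z ∈ Cⁿ` to `b ∈ Bⁿ`, then `d b = f a` for a unique cocycle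
`a ∈ Aⁿ⁺¹`, and `∂[z] = [a]`).

This file proves it CONCRETELY for `ℕ`-indexed cochain complexes of modules over a commutative
ring in the format `NatCochain.Cohomology` of `DoubleComplexExactRows` (sub-quotients
`ker dⁿ / im dⁿ⁻¹` of `R`-modules, cochain maps as families of linear maps), so that it applies
verbatim to the tree's concrete Čech complexes (`Literature.Geometry.Kaehler.CechDolbeault`,
`HolomorphicLineBundleCech.FramedCover.cohomology`, …), e.g. to the short exact sequences of Čech
complexes `0 → C•(𝔘, 𝒪(L ⊗ 𝓗ᵐ⁻¹)) → C•(𝔘, 𝒪(L ⊗ 𝓗ᵐ)) → C•(𝔘, Q_m) → 0` of the dimension count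
behind Serre's theorem A for line bundles (restriction to a hyperplane section).

* `NatCochain.ShortExactSeq dA dB dC` — the datum: cochain maps `f : A → B`, `g : B → C`,
  `f` injective, `g` surjective, `im f = ker g` termwise, and `dB ∘ dB = 0` (then `dA ∘ dA = 0`
  and `dC ∘ dC = 0` follow: `dA_dA`, `dC_dC`);
* `ShortExactSeq.delta S n : Hⁿ(C) →ₗ[R] Hⁿ⁺¹(A)` — the connecting homomorphism, with its
  computation rule `delta_mk` (ANY lift computes it);
* exactness: `injective_map_zero` (`H⁰(A) ↪ H⁰(B)`), `exact_map_map` (at `Hⁿ(B)`),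
  `exact_map_delta` (at `Hⁿ(C)`), `exact_delta_map` (at `Hⁿ⁺¹(A)`), all as `Function.Exact`
  statements about `NatCochain.Cohomology.map`.

Everything is elementary diagram chasing; no category theory (Mathlib's
`CategoryTheory.ShortComplex.ShortExact` / `HomologicalComplex.HomologySequence` is the abstract
counterpart, not used here because the consumers are concrete).

## References

* C. A. Weibel, *An Introduction to Homological Algebra*, CUP (1994), Thm. 1.3.1, Lemma 1.3.2
  (snake lemma), Ex. 1.3.3. [Weibel1994]
-/

namespace Literature.Algebra.Homology

universe u w w' w''

open Function

variable {R : Type u} [CommRing R]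

namespace NatCochain

variable {A : ℕ → Type w} [∀ n, AddCommGroup (A n)] [∀ n, Module R (A n)]
  {B : ℕ → Type w'} [∀ n, AddCommGroup (B n)] [∀ n, Module R (B n)]
  {C : ℕ → Type w''} [∀ n, AddCommGroup (C n)] [∀ n, Module R (C n)]

/-- **A short exact sequence `0 → A → B → C → 0` of `ℕ`-indexed cochain complexes of
`R`-modules**, concretely: cochain maps `f`, `g` (commuting with the differentials in the
convention of `NatCochain.Cohomology.map`), `f` injective, `g` surjective and `im fⁿ = ker gⁿ` in
every degree, together with `dB ∘ dB = 0` for the middle complex (which implies the same for `A`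
and `C`). [cite: Weibel1994, Thm. 1.3.1] -/
structure ShortExactSeq (dA : ∀ n, A n →ₗ[R] A (n + 1)) (dB : ∀ n, B n →ₗ[R] B (n + 1))
    (dC : ∀ n, C n →ₗ[R] C (n + 1)) where
  /-- the first cochain map `f : A → B` -/
  f : ∀ n, A n →ₗ[R] B n
  /-- the second cochain map `g : B → C` -/
  g : ∀ n, B n →ₗ[R] C n
  /-- `f` commutes with the differentials -/
  comm_f : ∀ n x, f (n + 1) (dA n x) = dB n (f n x)
  /-- `g` commutes with the differentials -/
  comm_g : ∀ n x, g (n + 1) (dB n x) = dC n (g n x)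
  /-- `f` is injective in every degree -/
  injective_f : ∀ n, Injective (f n)
  /-- `im f = ker g` in every degree -/
  exact_fg : ∀ n, Exact (f n) (g n)
  /-- `g` is surjective in every degree -/
  surjective_g : ∀ n, Surjective (g n)
  /-- the middle family is a complex -/
  dB_dB : ∀ n x, dB (n + 1) (dB n x) = 0

namespace ShortExactSeq

variable {dA : ∀ n, A n →ₗ[R] A (n + 1)} {dB : ∀ n, B n →ₗ[R] B (n + 1)}
  {dC : ∀ n, C n →ₗ[R] C (n + 1)} (S : ShortExactSeq dA dB dC)

/-- `g ∘ f = 0`. [folklore] -/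
theorem g_f (n : ℕ) (x : A n) : S.g n (S.f n x) = 0 :=
  (S.exact_fg n).apply_apply_eq_zero x

include S in
/-- `dA ∘ dA = 0` (from `dB ∘ dB = 0` and the injectivity of `f`). [folklore] -/
theorem dA_dA (n : ℕ) (x : A n) : dA (n + 1) (dA n x) = 0 :=
  S.injective_f _ (by rw [S.comm_f, S.comm_f, S.dB_dB, map_zero])

include S in
/-- `dC ∘ dC = 0` (from `dB ∘ dB = 0` and the surjectivity of `g`). [folklore] -/
theorem dC_dC (n : ℕ) (z : C n) : dC (n + 1) (dC n z) = 0 := by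
  obtain ⟨b, rfl⟩ := S.surjective_g n z
  rw [← S.comm_g, ← S.comm_g, S.dB_dB, map_zero]

/-- An element of `ker g` is in the image of `f`. [folklore] -/
theorem exists_f_eq_of_g_eq_zero {n : ℕ} {b : B n} (hb : S.g n b = 0) : ∃ a, S.f n a = b :=
  (S.exact_fg n b).1 hb

/-! ### Lifts through the snake -/

/-- **A snake lift of `z ∈ Cⁿ`**: `b ∈ Bⁿ` with `g b = z` and `a ∈ Aⁿ⁺¹` with `f a = dB b`
(Weibel, proof of 1.3.2). [cite: Weibel1994, Lemma 1.3.2] -/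
def IsLift (n : ℕ) (z : C n) (b : B n) (a : A (n + 1)) : Prop :=
  S.g n b = z ∧ S.f (n + 1) a = dB n b

/-- Every cocycle of `C` has a snake lift. [cite: Weibel1994, Lemma 1.3.2] -/
theorem exists_isLift (n : ℕ) {z : C n} (hz : z ∈ cocycles dC n) : ∃ b a, S.IsLift n z b a := by
  obtain ⟨b, hb⟩ := S.surjective_g n z
  have h : S.g (n + 1) (dB n b) = 0 := by rw [S.comm_g, hb, (mem_cocycles_iff dC).1 hz]
  obtain ⟨a, ha⟩ := S.exists_f_eq_of_g_eq_zero h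
  exact ⟨b, a, hb, ha⟩

section IsLiftLemmas

variable {S}

/-- The lifted element of `Aⁿ⁺¹` is a cocycle. [cite: Weibel1994, Lemma 1.3.2] -/
theorem IsLift.mem_cocycles {n : ℕ} {z : C n} {b : B n} {a : A (n + 1)} (h : S.IsLift n z b a) :
    a ∈ cocycles dA (n + 1) := by
  rw [mem_cocycles_iff]
  apply S.injective_f
  rw [S.comm_f, h.2, S.dB_dB, map_zero]

/-- Lifts add. [folklore] -/
theorem IsLift.add {n : ℕ} {z z' : C n} {b b' : B n} {a a' : A (n + 1)} (h : S.IsLift n z b a)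
    (h' : S.IsLift n z' b' a') : S.IsLift n (z + z') (b + b') (a + a') :=
  ⟨by rw [map_add, h.1, h'.1], by rw [map_add, map_add, h.2, h'.2]⟩

/-- Lifts scale. [folklore] -/
theorem IsLift.smul {n : ℕ} {z : C n} {b : B n} {a : A (n + 1)} (h : S.IsLift n z b a) (c : R) :
    S.IsLift n (c • z) (c • b) (c • a) :=
  ⟨by rw [map_smul, h.1], by rw [map_smul, map_smul, h.2]⟩

/-- **The connecting class is well defined**: the `A`-components of snake lifts of two cocycles
which differ by a coboundary differ by a coboundary. [cite: Weibel1994, Lemma 1.3.2] -/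
theorem IsLift.sub_mem_coboundaries {n : ℕ} {z z' : C n} {b b' : B n} {a a' : A (n + 1)}
    (h : S.IsLift n z b a) (h' : S.IsLift n z' b' a') (hzz' : z - z' ∈ coboundaries dC n) :
    a - a' ∈ coboundaries dA (n + 1) := by
  -- first find `e ∈ Bⁿ` with `dB e = 0` and `g (b - b' - e) = 0`
  obtain ⟨e, he, hge⟩ : ∃ e : B n, dB n e = 0 ∧ S.g n (b - b' - e) = 0 := by
    cases n with
    | zero =>
      rw [coboundaries_zero, Submodule.mem_bot, sub_eq_zero] at hzz'
      exact ⟨0, map_zero _, by rw [sub_zero, map_sub, h.1, h'.1, hzz', sub_self]⟩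
    | succ k =>
      obtain ⟨c, hc⟩ := (mem_coboundaries_succ_iff dC).1 hzz'
      obtain ⟨b₀, hb₀⟩ := S.surjective_g k c
      refine ⟨dB k b₀, S.dB_dB k b₀, ?_⟩
      rw [map_sub, map_sub, h.1, h'.1, S.comm_g, hb₀, hc, sub_self]
  obtain ⟨a₀, ha₀⟩ := S.exists_f_eq_of_g_eq_zero hge
  refine (mem_coboundaries_succ_iff dA).2 ⟨a₀, S.injective_f _ ?_⟩
  rw [S.comm_f, ha₀, map_sub, map_sub, he, sub_zero, map_sub, h.2, h'.2]

end IsLiftLemmas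

/-- `(0, 0)` lifts `0`. [folklore] -/
theorem isLift_zero (n : ℕ) : S.IsLift n 0 0 0 :=
  ⟨map_zero _, by rw [map_zero, map_zero]⟩

/-- A cocycle `b ∈ Zⁿ(B)` gives the lift `(b, 0)` of `g b`. [folklore] -/
theorem isLift_of_mem_cocycles {n : ℕ} {b : B n} (hb : b ∈ cocycles dB n) :
    S.IsLift n (S.g n b) b 0 :=
  ⟨rfl, by rw [map_zero, (mem_cocycles_iff dB).1 hb]⟩

/-! ### The connecting homomorphism -/

/-- A chosen `B`-component of a snake lift of a cocycle. [folklore] -/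
noncomputable def liftB (n : ℕ) (z : ↥(cocycles dC n)) : B n :=
  (S.exists_isLift n z.2).choose

/-- A chosen `A`-component of a snake lift of a cocycle. [folklore] -/
noncomputable def liftA (n : ℕ) (z : ↥(cocycles dC n)) : A (n + 1) :=
  (S.exists_isLift n z.2).choose_spec.choose

/-- The chosen components form a snake lift. [folklore] -/
theorem isLift_lift (n : ℕ) (z : ↥(cocycles dC n)) : S.IsLift n z (S.liftB n z) (S.liftA n z) :=
  (S.exists_isLift n z.2).choose_spec.choose_spec

/-- **The connecting homomorphism on cocycles**, `z ↦ [a]` for a snake lift `(b, a)` of `z`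
(linear because sums and multiples of lifts are lifts, and the class does not depend on the lift).
[cite: Weibel1994, Lemma 1.3.2] -/
noncomputable def deltaCocycles (n : ℕ) : ↥(cocycles dC n) →ₗ[R] Cohomology dA (n + 1) where
  toFun z := Cohomology.mk dA (n + 1) ⟨S.liftA n z, (S.isLift_lift n z).mem_cocycles⟩
  map_add' z z' := by
    rw [← map_add, Cohomology.mk_eq_mk_iff]
    exact (S.isLift_lift n (z + z')).sub_mem_coboundaries
      ((S.isLift_lift n z).add (S.isLift_lift n z')) (by rw [Submodule.coe_add, sub_self]; exact zero_mem _)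
  map_smul' c z := by
    rw [RingHom.id_apply, ← map_smul, Cohomology.mk_eq_mk_iff]
    exact (S.isLift_lift n (c • z)).sub_mem_coboundaries ((S.isLift_lift n z).smul c)
      (by rw [Submodule.coe_smul, sub_self]; exact zero_mem _)

/-- The connecting homomorphism on cocycles is computed by ANY snake lift. [cite: Weibel1994, Lemma 1.3.2] -/
theorem deltaCocycles_apply_of_isLift {n : ℕ} (z : ↥(cocycles dC n)) {b : B n} {a : A (n + 1)}
    (h : S.IsLift n z b a) :
    S.deltaCocycles n z = Cohomology.mk dA (n + 1) ⟨a, h.mem_cocycles⟩ := by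
  change Cohomology.mk dA (n + 1) ⟨S.liftA n z, (S.isLift_lift n z).mem_cocycles⟩ = _
  rw [Cohomology.mk_eq_mk_iff]
  exact (S.isLift_lift n z).sub_mem_coboundaries h (by rw [sub_self]; exact zero_mem _)

/-- The connecting homomorphism on cocycles kills the coboundaries. [cite: Weibel1994, Lemma 1.3.2] -/
theorem deltaCocycles_eq_zero_of_mem {n : ℕ} (z : ↥(cocycles dC n))
    (hz : (z : C n) ∈ coboundaries dC n) : S.deltaCocycles n z = 0 := by
  change Cohomology.mk dA (n + 1) ⟨S.liftA n z, (S.isLift_lift n z).mem_cocycles⟩ = 0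
  rw [Cohomology.mk_eq_zero_iff]
  have h := (S.isLift_lift n z).sub_mem_coboundaries (S.isLift_zero n) (by rwa [sub_zero])
  rwa [sub_zero] at h

/-- **The connecting homomorphism `∂ : Hⁿ(C) → Hⁿ⁺¹(A)`** of a short exact sequence of cochain
complexes (Weibel, Thm. 1.3.1; Lemma 1.3.2 for the construction). [cite: Weibel1994, Thm. 1.3.1] -/
noncomputable def delta (n : ℕ) : Cohomology dC n →ₗ[R] Cohomology dA (n + 1) :=
  ((coboundaries dC n).comap (cocycles dC n).subtype).liftQ (S.deltaCocycles n) fun z hz ↦ by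
    rw [LinearMap.mem_ker]
    exact S.deltaCocycles_eq_zero_of_mem z (by simpa only [Submodule.mem_comap, Submodule.subtype_apply] using hz)

/-- **Computation rule for `∂`**: if `g b = z` and `f a = dB b` then `∂ [z] = [a]`.
[cite: Weibel1994, Lemma 1.3.2] -/
theorem delta_mk {n : ℕ} (z : ↥(cocycles dC n)) {b : B n} {a : A (n + 1)} (h : S.IsLift n z b a) :
    S.delta n (Cohomology.mk dC n z) = Cohomology.mk dA (n + 1) ⟨a, h.mem_cocycles⟩ := by
  rw [← S.deltaCocycles_apply_of_isLift z h]
  rfl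

/-! ### Exactness -/

/-- **`H⁰(A) → H⁰(B)` is injective.** [cite: Weibel1994, Thm. 1.3.1] -/
theorem injective_map_zero : Injective (Cohomology.map S.f S.comm_f 0) := by
  intro c c' hcc'
  obtain ⟨x, rfl⟩ := Cohomology.mk_surjective dA 0 c
  obtain ⟨x', rfl⟩ := Cohomology.mk_surjective dA 0 c'
  rw [Cohomology.map_mk, Cohomology.map_mk, Cohomology.mk_eq_mk_iff, coboundaries_zero,
    Submodule.mem_bot, Cohomology.coe_mapCocycles, Cohomology.coe_mapCocycles, ← map_sub] at hcc'
  rw [Cohomology.mk_eq_mk_iff, coboundaries_zero, Submodule.mem_bot]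
  exact S.injective_f 0 (by rw [hcc', map_zero])

/-- **Exactness at `Hⁿ(B)`**: `im (Hⁿ(f)) = ker (Hⁿ(g))`. [cite: Weibel1994, Thm. 1.3.1] -/
theorem exact_map_map (n : ℕ) :
    Exact (Cohomology.map S.f S.comm_f n) (Cohomology.map S.g S.comm_g n) := by
  intro c
  constructor
  · intro hc
    obtain ⟨y, rfl⟩ := Cohomology.mk_surjective dB n c
    rw [Cohomology.map_mk, Cohomology.mk_eq_zero_iff, Cohomology.coe_mapCocycles] at hc
    -- find `e` with `dB e = 0`, `y - e ∈ Zⁿ(B)` a coboundary shift, and `g (y - e) = 0`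
    obtain ⟨e, he, hey, hge⟩ : ∃ e : B n, dB n e = 0 ∧ e ∈ coboundaries dB n ∧ S.g n (y - e) = 0 := by
      cases n with
      | zero =>
        rw [coboundaries_zero, Submodule.mem_bot] at hc
        exact ⟨0, map_zero _, zero_mem _, by rw [sub_zero, hc]⟩
      | succ k =>
        obtain ⟨w, hw⟩ := (mem_coboundaries_succ_iff dC).1 hc
        obtain ⟨b₀, hb₀⟩ := S.surjective_g k w
        exact ⟨dB k b₀, S.dB_dB k b₀, (mem_coboundaries_succ_iff dB).2 ⟨b₀, rfl⟩,
          by rw [map_sub, S.comm_g, hb₀, hw, sub_self]⟩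
    obtain ⟨a, ha⟩ := S.exists_f_eq_of_g_eq_zero hge
    have hac : a ∈ cocycles dA n := by
      rw [mem_cocycles_iff]
      apply S.injective_f
      rw [S.comm_f, ha, map_sub, he, sub_zero, (mem_cocycles_iff dB).1 y.2, map_zero]
    refine ⟨Cohomology.mk dA n ⟨a, hac⟩, ?_⟩
    rw [Cohomology.map_mk, Cohomology.mk_eq_mk_iff, Cohomology.coe_mapCocycles]
    change S.f n a - (y : B n) ∈ coboundaries dB n
    rw [ha, sub_sub_cancel_left]
    exact neg_mem hey
  · rintro ⟨c', rfl⟩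
    obtain ⟨x, rfl⟩ := Cohomology.mk_surjective dA n c'
    rw [Cohomology.map_mk, Cohomology.map_mk, Cohomology.mk_eq_zero_iff, Cohomology.coe_mapCocycles,
      Cohomology.coe_mapCocycles, S.g_f]
    exact zero_mem _

/-- **Exactness at `Hⁿ(C)`**: `im (Hⁿ(g)) = ker ∂`. [cite: Weibel1994, Thm. 1.3.1] -/
theorem exact_map_delta (n : ℕ) : Exact (Cohomology.map S.g S.comm_g n) (S.delta n) := by
  intro c
  constructor
  · intro hc
    obtain ⟨z, rfl⟩ := Cohomology.mk_surjective dC n c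
    obtain ⟨b, a, h⟩ := S.exists_isLift n z.2
    rw [S.delta_mk z h, Cohomology.mk_eq_zero_iff] at hc
    obtain ⟨a₁, ha₁⟩ := (mem_coboundaries_succ_iff dA).1 hc
    have hb : b - S.f n a₁ ∈ cocycles dB n := by
      rw [mem_cocycles_iff, map_sub, ← S.comm_f, ha₁, h.2, sub_self]
    refine ⟨Cohomology.mk dB n ⟨b - S.f n a₁, hb⟩, ?_⟩
    rw [Cohomology.map_mk]
    congr 1
    apply Subtype.ext
    rw [Cohomology.coe_mapCocycles]
    change S.g n (b - S.f n a₁) = (z : C n)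
    rw [map_sub, S.g_f, sub_zero, h.1]
  · rintro ⟨c', rfl⟩
    obtain ⟨y, rfl⟩ := Cohomology.mk_surjective dB n c'
    rw [Cohomology.map_mk, S.delta_mk _ (S.isLift_of_mem_cocycles y.2), Cohomology.mk_eq_zero_iff]
    exact zero_mem _

/-- **Exactness at `Hⁿ⁺¹(A)`**: `im ∂ = ker (Hⁿ⁺¹(f))`. [cite: Weibel1994, Thm. 1.3.1] -/
theorem exact_delta_map (n : ℕ) : Exact (S.delta n) (Cohomology.map S.f S.comm_f (n + 1)) := by
  intro c
  constructor
  · intro hc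
    obtain ⟨x, rfl⟩ := Cohomology.mk_surjective dA (n + 1) c
    rw [Cohomology.map_mk, Cohomology.mk_eq_zero_iff, Cohomology.coe_mapCocycles] at hc
    obtain ⟨b, hb⟩ := (mem_coboundaries_succ_iff dB).1 hc
    have hz : S.g n b ∈ cocycles dC n := by
      rw [mem_cocycles_iff, ← S.comm_g, hb, S.g_f]
    have h : S.IsLift n (S.g n b) b x := ⟨rfl, hb.symm⟩
    exact ⟨Cohomology.mk dC n ⟨S.g n b, hz⟩, S.delta_mk ⟨S.g n b, hz⟩ h⟩
  · rintro ⟨c', rfl⟩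
    obtain ⟨z, rfl⟩ := Cohomology.mk_surjective dC n c'
    obtain ⟨b, a, h⟩ := S.exists_isLift n z.2
    rw [S.delta_mk z h, Cohomology.map_mk, Cohomology.mk_eq_zero_iff, Cohomology.coe_mapCocycles]
    exact (mem_coboundaries_succ_iff dB).2 ⟨b, h.2.symm⟩

/-- `Hⁿ(g) ∘ Hⁿ(f) = 0`. [folklore] -/
theorem map_map_eq_zero (n : ℕ) (c : Cohomology dA n) :
    Cohomology.map S.g S.comm_g n (Cohomology.map S.f S.comm_f n c) = 0 :=
  (S.exact_map_map n).apply_apply_eq_zero c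

/-- `∂ ∘ Hⁿ(g) = 0`. [folklore] -/
theorem delta_map_eq_zero (n : ℕ) (c : Cohomology dB n) :
    S.delta n (Cohomology.map S.g S.comm_g n c) = 0 :=
  (S.exact_map_delta n).apply_apply_eq_zero c

/-- `Hⁿ⁺¹(f) ∘ ∂ = 0`. [folklore] -/
theorem map_delta_eq_zero (n : ℕ) (c : Cohomology dC n) :
    Cohomology.map S.f S.comm_f (n + 1) (S.delta n c) = 0 :=
  (S.exact_delta_map n).apply_apply_eq_zero c

end ShortExactSeq

end NatCochain

end Literature.Algebra.Homology
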